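import Literature.Probability.LatticeModels.AnisotropicIsing
import HarnessLib

/-!
# The anisotropic Ising model on `ℤ^d`: elementary API and sanity theorems

Sibling proof file of `Literature.Probability.LatticeModels.AnisotropicIsing` (which, containing
the definitions `axisCoupling`, `anisoHamiltonian`, `anisoMeasure`, `anisoExpect`,
`anisoPlusExpect`, `anisoCorr`, `anisoCriticalBeta` of definition item `defn-anisoPlusExpect`, is
review-gated; theorems live here). Theorems only — no definitions, no named facts:

* `axisCoupling_single_swap`, `axisCoupling_nonneg` (ferromagnetic axis couplings give
  nonnegative edge couplings);
* the finite-sum picture of the finite-volume Gibbs expectation (Friedli–Velenik 2017, §3.1,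
  eq. (3.8)): `integral_exp_anisoHamiltonian` (the normalising integral is the Boltzmann sum),
  `anisoPartitionSum_pos`, `anisoExpect_eq_sum_div`, `anisoExpect_const_fun`, `norm_anisoExpect_le`;
* **uniform couplings rescale `β`** (Friedli–Velenik 2017, §3.6.1, after eq. (3.20): "we recover
  `ℋ_{Λ;β,h}` … by setting `J_{ij} = β`"): with all axis couplings equal to `c`, the zero-field
  model at `β` is the isotropic model at `cβ` — `anisoHamiltonian_const_zero_field`,
  `anisoMeasure_const_zero_field`, `anisoExpect_const_zero_field`,
  `anisoPlusExpect_const_zero_field`, and `anisoCriticalBeta_const : β_c(c,…,c) = β_c(d)/c`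
  (`c > 0`);
* the sanity lemma requested with the definition and not in the definition file:
  **`anisoCriticalBeta_one : anisoCriticalBeta d (1,…,1) = criticalBeta d`** (both are
  `inf {β ≥ 0 | ⟨σ₀⟩⁺_{β,0} > 0}`: `spontaneousMagnetization d β` is `plusExpect d β 0 (spinAt 0)`
  by definition, and `anisoPlusExpect_one`), with `anisoCorr_one_anisoCriticalBeta`;
* `anisoPlusExpect_eq_of_tendsto` (the `limUnder` takes the value of a convergent box sequence).

Locators were checked on the held copy of Friedli–Velenik 2017 (`book:friedli2017-…`): the
edge-coupling Hamiltonian `ℋ_{Λ;𝐉,𝐡}` is eq. (3.20) in §3.6.1 (p. 109 of the PDF), the plus state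
is Thm. 3.17 (§3.4), and `β_c(d) = inf{β ≥ 0 : m*(β) > 0}` is Definition 3.32, eq. (3.27).

## References

* [FriedliVelenik2017] S. Friedli, Y. Velenik, *Statistical Mechanics of Lattice Systems*
  (CUP 2017), §3.1 eq. (3.8), §3.4 Thm. 3.17, §3.6.1 eq. (3.20), Definition 3.32 eq. (3.27).
-/

noncomputable section

open MeasureTheory Filter Topology Finset
open scoped Pointwise

namespace Literature.Probability.LatticeModels

variable {d : ℕ}

/-- On the lattice edge `{x + e_i, x}` (reverse orientation of `axisCoupling_single`) the axis
coupling is `J_i`. [folklore] -/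
theorem axisCoupling_single_swap (J : Fin d → ℝ) (x : Site d) (i : Fin d) :
    axisCoupling J s(x + Pi.single i 1, x) = J i := by
  rw [Sym2.eq_swap, axisCoupling_single]

/-- Interacting edges are lattice edges (both boundary conditions); a private copy of
`mem_edgeSet_of_mem_interactionEdges` of `GKSInequalities` (not imported here).
[cite: FriedliVelenik2017, §3.1] -/
private theorem mem_edgeSet_of_mem_interactionEdges' {Λ : Finset (Site d)}
    {bc : BoundaryCondition (Site d)} {e : Sym2 (Site d)}
    (he : e ∈ interactionEdges (zdGraph d) Λ bc) : e ∈ (zdGraph d).edgeSet := by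
  cases bc with
  | free => exact (mem_edgesIn_iff.1 (by simpa using he)).1
  | fixed η => exact (mem_edgesTouching_iff.1 (by simpa using he)).1

/-- Nonnegative (ferromagnetic) axis couplings give nonnegative edge couplings
(Friedli–Velenik 2017, §3.6.1: nonnegative `J_{ij}`). [cite: FriedliVelenik2017, §3.6.1 eq. (3.20)] -/
theorem axisCoupling_nonneg {J : Fin d → ℝ} (hJ : ∀ i, 0 ≤ J i) (e : Sym2 (Site d)) :
    0 ≤ axisCoupling J e := by
  induction e using Sym2.ind with
  | _ x y =>
    rw [axisCoupling_mk]
    exact Finset.sum_nonneg fun i _ => by split_ifs; exacts [le_rfl, hJ i]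

/-- The normalising integral of the tilt is the Boltzmann sum over finite configurations:
`∫ e^{-βH} d(isingRef Λ bc) = ∑_τ e^{-βH(glue τ)}` (the partition function `Z^{bc}_{Λ;J,β,h}`).
[cite: FriedliVelenik2017, §3.1 eq. (3.4)] -/
theorem integral_exp_anisoHamiltonian (J : Fin d → ℝ) (Λ : Finset (Site d)) (β h : ℝ)
    (bc : BoundaryCondition (Site d)) :
    ∫ σ, Real.exp (-β * anisoHamiltonian J Λ h bc σ) ∂isingRef Λ bc =
      ∑ τ : Λ → ℤˣ, Real.exp (-β * anisoHamiltonian J Λ h bc (glue Λ τ bc)) := by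
  have hm : Measurable fun σ => Real.exp (-β * anisoHamiltonian J Λ h bc σ) :=
    Real.measurable_exp.comp ((measurable_anisoHamiltonian J Λ h bc).const_mul _)
  rw [isingRef, integral_map (measurable_glue Λ bc).aemeasurable hm.aestronglyMeasurable,
    integral_fintype Integrable.of_finite]
  simp

/-- The partition function `∑_τ e^{-βH(glue τ)}` is positive. [folklore] -/
theorem anisoPartitionSum_pos (J : Fin d → ℝ) (Λ : Finset (Site d)) (β h : ℝ)
    (bc : BoundaryCondition (Site d)) :
    0 < ∑ τ : Λ → ℤˣ, Real.exp (-β * anisoHamiltonian J Λ h bc (glue Λ τ bc)) :=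
  Finset.sum_pos (fun _ _ => Real.exp_pos _) Finset.univ_nonempty

/-- **Expectations are finite Boltzmann-weighted averages**:
`⟨f⟩^{bc}_{Λ;J,β,h} = (∑_τ e^{-βH(glue τ)} f(glue τ)) / ∑_τ e^{-βH(glue τ)}` for measurable `f`
(Friedli–Velenik 2017, §3.1 eq. (3.8); as `integral_isingMeasure`). [cite: FriedliVelenik2017, §3.1 eq. (3.8)] -/
theorem anisoExpect_eq_sum_div (J : Fin d → ℝ) (Λ : Finset (Site d)) (β h : ℝ)
    (bc : BoundaryCondition (Site d)) {f : SpinConfig (Site d) → ℝ} (hf : Measurable f) :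
    anisoExpect J Λ β h bc f =
      (∑ τ : Λ → ℤˣ, Real.exp (-β * anisoHamiltonian J Λ h bc (glue Λ τ bc)) * f (glue Λ τ bc)) /
        ∑ τ : Λ → ℤˣ, Real.exp (-β * anisoHamiltonian J Λ h bc (glue Λ τ bc)) := by
  set Z := ∑ τ : Λ → ℤˣ, Real.exp (-β * anisoHamiltonian J Λ h bc (glue Λ τ bc)) with hZ
  have hm : Measurable fun σ => Real.exp (-β * anisoHamiltonian J Λ h bc σ) :=
    Real.measurable_exp.comp ((measurable_anisoHamiltonian J Λ h bc).const_mul _)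
  have hm' : Measurable fun σ => (Real.exp (-β * anisoHamiltonian J Λ h bc σ) / Z) • f σ :=
    (hm.div_const _).smul hf
  rw [anisoExpect, anisoMeasure, integral_tilted, integral_exp_anisoHamiltonian, ← hZ, isingRef,
    integral_map (measurable_glue Λ bc).aemeasurable hm'.aestronglyMeasurable]
  simp only [smul_eq_mul]
  rw [integral_fintype Integrable.of_finite, Finset.sum_div]
  refine Finset.sum_congr rfl fun τ _ => ?_
  simp only [count_real_singleton]
  ring

/-- Expectation of a constant observable. [folklore] -/
@[simp] theorem anisoExpect_const_fun (J : Fin d → ℝ) (Λ : Finset (Site d)) (β h : ℝ)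
    (bc : BoundaryCondition (Site d)) (c : ℝ) : anisoExpect J Λ β h bc (fun _ => c) = c := by
  simp [anisoExpect]

/-- `‖⟨f⟩‖ ≤ C` when `‖f‖ ≤ C` pointwise (expectation under a probability measure).
[cite: FriedliVelenik2017, §3.1 eq. (3.8)] -/
theorem norm_anisoExpect_le (J : Fin d → ℝ) (Λ : Finset (Site d)) (β h : ℝ)
    (bc : BoundaryCondition (Site d)) {f : SpinConfig (Site d) → ℝ} {C : ℝ} (hC : ∀ σ, ‖f σ‖ ≤ C) :
    ‖anisoExpect J Λ β h bc f‖ ≤ C := by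
  unfold anisoExpect
  simpa using norm_integral_le_of_norm_le_const (μ := anisoMeasure J Λ β h bc) (ae_of_all _ hC)

/-- **Uniform couplings rescale `β`** (zero field): with all axis couplings equal to `c`,
`H_{Λ;(c,…,c),0} = c · H_{Λ;0}` for the isotropic zero-field Hamiltonian
(Friedli–Velenik 2017, §3.6.1: `J_{ij} = β` recovers `ℋ_{Λ;β,h}`). [cite: FriedliVelenik2017, §3.6.1 eq. (3.20)] -/
theorem anisoHamiltonian_const_zero_field (c : ℝ) (Λ : Finset (Site d))
    (bc : BoundaryCondition (Site d)) (σ : SpinConfig (Site d)) :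
    anisoHamiltonian (fun _ => c) Λ 0 bc σ = c * isingHamiltonian (zdGraph d) Λ 0 bc σ := by
  unfold anisoHamiltonian isingHamiltonian
  have hsum : ∑ e ∈ interactionEdges (zdGraph d) Λ bc, axisCoupling (fun _ => c) e * bondSpin σ e =
      c * ∑ e ∈ interactionEdges (zdGraph d) Λ bc, bondSpin σ e := by
    rw [Finset.mul_sum]
    exact Finset.sum_congr rfl fun e he => by
      rw [axisCoupling_const_of_mem_edgeSet c (mem_edgeSet_of_mem_interactionEdges' he)]
  rw [hsum]
  ring

/-- With all axis couplings equal to `c`, the zero-field Gibbs measure at `β` is the isotropic one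
at `cβ`. [cite: FriedliVelenik2017, §3.6.1 eq. (3.20)] -/
theorem anisoMeasure_const_zero_field (c : ℝ) (Λ : Finset (Site d)) (β : ℝ)
    (bc : BoundaryCondition (Site d)) :
    anisoMeasure (fun _ => c) Λ β 0 bc = isingMeasure (zdGraph d) Λ (c * β) 0 bc := by
  unfold anisoMeasure isingMeasure
  congr 1
  funext σ
  rw [anisoHamiltonian_const_zero_field]
  ring

/-- With all axis couplings equal to `c`, zero-field expectations at `β` are the isotropic ones at
`cβ`. [cite: FriedliVelenik2017, §3.6.1 eq. (3.20)] -/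
theorem anisoExpect_const_zero_field (c : ℝ) (Λ : Finset (Site d)) (β : ℝ)
    (bc : BoundaryCondition (Site d)) (f : SpinConfig (Site d) → ℝ) :
    anisoExpect (fun _ => c) Λ β 0 bc f = isingExpect (zdGraph d) Λ (c * β) 0 bc f := by
  rw [anisoExpect, isingExpect, anisoMeasure_const_zero_field]

variable (d)

/-- If the `+`-b.c. box expectations converge to `a`, the plus state equals `a`. [folklore] -/
theorem anisoPlusExpect_eq_of_tendsto {J : Fin d → ℝ} {β h : ℝ} {f : SpinConfig (Site d) → ℝ}
    {a : ℝ} (ha : Tendsto (fun L : ℕ => anisoExpect J (box d L) β h .plus f) atTop (𝓝 a)) :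
    anisoPlusExpect d J β h f = a :=
  ha.limUnder_eq

/-- With all axis couplings equal to `c`, the zero-field plus state at `β` is the isotropic plus
state at `cβ`. [cite: FriedliVelenik2017, §3.4 Thm. 3.17] -/
theorem anisoPlusExpect_const_zero_field (c β : ℝ) (f : SpinConfig (Site d) → ℝ) :
    anisoPlusExpect d (fun _ => c) β 0 f = plusExpect d (c * β) 0 f := by
  simp only [anisoPlusExpect, plusExpect, anisoExpect_const_zero_field]

/-- **Sanity (requested with the definition): unit couplings recover the isotropic critical
point**, `anisoCriticalBeta d (1, …, 1) = criticalBeta d` — both are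
`inf {β ≥ 0 | ⟨σ₀⟩⁺_{β,0} > 0}`, since `spontaneousMagnetization d β` is `⟨σ₀⟩⁺_{β,0}` by
definition and `anisoPlusExpect_one`. [cite: FriedliVelenik2017, Definition 3.32 eq. (3.27)] -/
theorem anisoCriticalBeta_one : anisoCriticalBeta d (fun _ => (1 : ℝ)) = criticalBeta d := by
  simp only [anisoCriticalBeta, criticalBeta, spontaneousMagnetization, anisoPlusExpect_one]

/-- Unit couplings at the anisotropic critical point recover the critical correlators:
`anisoCorr d (1,…,1) (anisoCriticalBeta d (1,…,1)) = criticalCorr d`. [folklore] -/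
theorem anisoCorr_one_anisoCriticalBeta :
    anisoCorr d (fun _ => (1 : ℝ)) (anisoCriticalBeta d fun _ => (1 : ℝ)) = criticalCorr d := by
  rw [anisoCriticalBeta_one, anisoCorr_one_criticalBeta]

/-- With all axis couplings equal to `c > 0`, `β_c(c, …, c) = β_c(d) / c`: the defining set of
`anisoCriticalBeta` is `c⁻¹ •` that of `criticalBeta` (`anisoPlusExpect_const_zero_field`), and
`sInf` commutes with multiplication by `c⁻¹ ≥ 0` (`Real.sInf_smul_of_nonneg`).
[cite: FriedliVelenik2017, Definition 3.32 eq. (3.27)] -/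
theorem anisoCriticalBeta_const {c : ℝ} (hc : 0 < c) :
    anisoCriticalBeta d (fun _ => c) = criticalBeta d / c := by
  simp only [anisoCriticalBeta, criticalBeta, spontaneousMagnetization,
    anisoPlusExpect_const_zero_field]
  have hset : {β : ℝ | 0 ≤ β ∧ 0 < plusExpect d (c * β) 0 (spinAt 0)} =
      c⁻¹ • {β : ℝ | 0 ≤ β ∧ 0 < plusExpect d β 0 (spinAt 0)} := by
    ext β
    rw [Set.mem_smul_set]
    constructor
    · rintro ⟨hβ, hm⟩
      exact ⟨c * β, ⟨mul_nonneg hc.le hβ, hm⟩, by rw [smul_eq_mul, inv_mul_cancel_left₀ hc.ne']⟩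
    · rintro ⟨γ, ⟨hγ, hm⟩, rfl⟩
      refine ⟨by rw [smul_eq_mul]; exact mul_nonneg (inv_nonneg.2 hc.le) hγ, ?_⟩
      rwa [smul_eq_mul, mul_inv_cancel_left₀ hc.ne']
  rw [hset, Real.sInf_smul_of_nonneg (inv_nonneg.2 hc.le), smul_eq_mul, div_eq_inv_mul]

end Literature.Probability.LatticeModels
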